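import Summits.HodgeConjecture.HodgeConjecture.Theses.PadicSemiregularLift
import Summits.HodgeConjecture.HodgeConjecture.Theorems.FormalVectorBundlesAlgebraize.Negative.TowerTightness
import Literature.AlgebraicGeometry.Resolution.ChowLemmaRing
import Mathlib.LinearAlgebra.FreeModule.StrongRankCondition

/-!
# Line `twist-presentation-completeness` for the crux `FormalVectorBundlesAlgebraize`
(stmt-HodgeConjecture-14106, route `PadicSemiregularLift`, item P3a) — CHECKED SKELETON

Crux-plan of idea `Ideas/twist-presentation-completeness.md` (lead card of the ENGINE merge
cluster {twist-presentation-completeness ≈ flat-ladder-graded-limit ≈ flat-tower-uniform-serre},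
TRIAGE-r1-{1,2,3}: pass ×3), sharpened by the three triage reports and by the standing
disprover's `Cruxes/FormalVectorBundlesAlgebraize/Disproof.lean` (cycle 1: NO KILL — theorem in
print, EGA III₁ 5.1.4 + GW II 24.95/24.96; `crux_of_properOnly`: only `IsProper` is load-bearing).

## Shape (4 registered stubs; everything else is proved here)

The crux says: on a smooth proper model `𝒳/W(k)`, a formal vector bundle `(E n)` on the
`p`-adic tower `X_{n+1} = 𝒳 ⊗ W/pⁿ⁺¹` with `E 0|X_k ≅ E₁` comes from an algebraic vector bundle:
`LiftsFormally 𝒳 E₁ → LiftsTo 𝒳 E₁`.  The line proves it as FRAME ∘ ENGINE: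

* `stub_chowFlatCover` (S1, frame) — a smooth proper model `𝒳` receives a `W`-morphism
  `π : Z ⟶ 𝒳` from a `W`-FLAT, `W`-PROJECTIVE `Z` (closed `W`-subscheme of some `ℙᴺ_W`) with
  `π_* 𝒪_Z = 𝒪_𝒳` (Chow's lemma for the integral `𝒳`, flatness of the integral dominant `Z`
  over the DVR `W`, Zariski/Stein towards the normal — because regular — `𝒳`).
* `stub_twistPresentation` (S3, ENGINE, HARDEST — the idea's lever) — for a closed `W`-immersion
  `ι : Z ↪ ℙᴺ_W` with `Z` `W`-flat, every formal vector bundle `(F n)` on `Z` is, level by level,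
  the restriction of `ι^* coker u` for ONE algebraic morphism `u : V' ⟶ V` of algebraic vector
  bundles ON `ℙᴺ_W`.  Paper: push the tower into `ℙᴺ_W`; the flat `p`-adic ladder `0 → G₁ → G_{n+1} → G_n → 0`
  (`G_n = ι_{n*}F_{n-1}`) makes ONE pair of Serre bounds on `ℙᴺ_k` (for `G₁` and for the first
  syzygy `K₁`) serve every level, giving compatible twist presentations
  `u_n ∈ Mat_{r×s}(W_n[x₀,…,x_N]_b)`; `Hom(𝒪(-m')^s, 𝒪(-m)^r)` on `ℙᴺ_{W_n}` is polynomial for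
  EVERY `n`, so `(u_n)` converges coefficientwise in the `p`-adically complete `W` — no theorem on
  formal functions, no Artin–Rees, no Mittag-Leffler; `V, V'` are the sums of twists and
  `(ι^* coker u)|Z_{n+1} ≅ ι_{n+1}^* ι_{n+1,*} F_n ≅ F_n` by right exactness.
* `stub_formallyFreeCokernel` (S4, engine finish = GW II Prop 24.95 + Lemma 24.96, the idea card's
  First lemma) — on a proper `W`-scheme, the cokernel of a morphism of vector bundles all of
  whose restrictions to the thickenings `Z_{n+1}` are vector bundles is a vector bundle (local
  criterion of flatness at the points of `Z_k`, then "an open neighbourhood of the special fibre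
  of a proper `W`-scheme is everything").
* `stub_pushforwardDescent` (S2, frame) — for `π : Z ⟶ 𝒳` as in S1 and an algebraic vector
  bundle `G` on `Z` restricting on every `Z_{n+1}` to the pull-back of `E n`, the direct image
  `π_* G` is a vector bundle on `𝒳` with `(π_* G)|X_1 ≅ E 0` (one-level frame lifting with the
  torsion exponent of the finite `H¹(Z_A, G)`, projection formula, `π_*𝒪 = 𝒪`, Lemma 24.96 on `𝒳`).

PROVED here (sorry-free): the vector-bundle converse `IsVectorBundle → IsFiniteLocallyFree`
(credit: refuter-cdisprove-stmt-HodgeConjecture-13825, `Cruxes/FormalLiftingFromClassLifting/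
Disproof.lean` §12, copied so that this file imports nothing sorried), hence pull-backs and
isomorphic copies of vector bundles are vector bundles; the base-change square
`Z_m ⟶ Z_n ⟶ X_n = Z_m ⟶ X_m ⟶ X_n` and the pulled-back tower; the composition
`liftsTo_of_obligations : S1 → S2 → S3 → S4 → (crux statement)` (axioms: propext,
Classical.choice, Quot.sound) and `FormalVectorBundlesAlgebraize_of : FormalVectorBundlesAlgebraize`
(the crux BY NAME; `sorryAx` enters only through the four `stub_*`); and the PROJECTIVE CASE
`projectiveCase_of_engine : S3 → S4 → (crux restricted to W-projective 𝒳)` — the two ENGINE stubs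
alone close the crux for every `𝒳` carrying `Crystalline.IsProjectiveOverRing 𝒳` (all anchors and
every consumer in the route; triage panel note P1(b)).

## Disproof used (`Cruxes/FormalVectorBundlesAlgebraize/Disproof.lean`, cycle 1)

Honours `not_withoutProper` (properness is used: S1 = Chow, S2 and S4 = Lemma 24.96 / finiteness),
`not_withoutLiftsFormally` (the whole tower is consumed by S3), avoids the refuted strengthening
`UniqueAlgebraization` (no uniqueness claimed anywhere), respects the tightness lemma
`liftsFormally_of_algebraicLift`; composition shaped after `crux_of_grothendieckExistenceVB`
with `GrothendieckExistenceVB` REPLACED by S3 ∘ S4 (never assumed).  Landed Negative lemmas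
(`Theorems/FormalVectorBundlesAlgebraize/Negative/TowerTightness.lean`) are IMPORTED and used
(`thickeningMap_snd`); none refutes an instance of a stub (they are bookkeeping/tightness).
-/

set_option linter.dupNamespace false

namespace Summit.HodgeConjecture.HodgeConjecture.Cruxes.FormalVectorBundlesAlgebraize.TwistPresentationCompleteness

open CategoryTheory AlgebraicGeometry Limits
open Literature.AlgebraicGeometry
open Literature.AlgebraicGeometry.Motives Literature.AlgebraicGeometry.Motives.WittScheme
open Literature.AlgebraicGeometry.Resolution
open Summit.HodgeConjecture.HodgeConjecture.Theses.PadicSemiregularLift (FormalVectorBundlesAlgebraize)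
open Summit.HodgeConjecture.HodgeConjecture.Theorems.FormalVectorBundlesAlgebraize.Negative
  (thickeningMap_snd)

noncomputable section

/-! ## 1. The registered stubs (the ONLY sorries of this file; statements over tree vocabulary) -/

section Stubs

/-- **S1 (frame) — CHOW–STEIN FLAT PROJECTIVE COVER of a smooth proper model.**  For `𝒳/W(k)` a
smooth proper model there are a `W`-scheme `Z`, projective over `W` (closed `W`-immersion into
some `ℙᴺ_W`, `ChowLemmaRing.IsProjOver`) and FLAT over `W`, and a `W`-morphism `π : Z ⟶ 𝒳` with
`π_* 𝒪_Z = 𝒪_𝒳` (pull-back of functions bijective on every open).  Paper: `𝒳` is integral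
(W-flat with geometrically irreducible generic fibre, smooth over the reduced `W` ⇒ reduced), so
Chow's lemma (`ChowLemmaRing.chow_proper`, PROVED) gives an integral `Z ↪ ℙᴺ_W` closed with
`π` proper surjective and birational; `Z` is `W`-flat (`ZariskiChow.flat_of_isIntegral_of_surjective`);
`π_*𝒪_Z = 𝒪_𝒳` by Zariski/Stein towards the normal `𝒳` (`TowardsNormal.bijective_app`; `𝒳` is
regular, `isRegularLocalRing_stalk_of_smoothOfRelativeDimension_specOfRegular`, hence normal,
`isIntegrallyClosed_of_isRegularLocalRing`).  Size M. -/
theorem stub_chowFlatCover :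
    ∀ (p : ℕ) [Fact p.Prime] (k : Type) [Field k] [CharP k p] [PerfectRing k p] (d : ℕ)
      (𝒳 : SchemeOver (WittVector p k)), IsSmoothProperModel d 𝒳 →
      ∃ (Z : SchemeOver (WittVector p k)) (π : Z ⟶ 𝒳),
        ChowLemmaRing.IsProjOver Z ∧ Flat Z.hom ∧
          ∀ U : 𝒳.left.Opens, Function.Bijective (π.left.app U).hom := by
  sorry

/-- **S2 (frame) — PUSH-FORWARD DESCENT along `π_* 𝒪_Z = 𝒪_𝒳`.**  `𝒳` proper over `W = W(k)`;
`π : Z ⟶ 𝒳` a `W`-morphism from a `W`-projective `W`-flat `Z` with `π_* 𝒪_Z = 𝒪_𝒳`; `(E n)` a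
formal vector bundle on the thickenings `X_{n+1}` of `𝒳`; `G` an ALGEBRAIC vector bundle on `Z`
with `G|Z_{n+1} ≅ π_{n+1}^* (E n)` for every `n` (level-wise isomorphisms, no compatibility asked).
THEN `π_* G` is a vector bundle on `𝒳` and `(π_* G)|X_1 ≅ E 0`.  Paper (card `chow-frame-descent`
(L), checked by all three triagers): over an affine `U = Spec A ⊆ 𝒳` on which `E 0` is free,
`Z_U ↪ ℙᴺ_A` is closed, so `H¹(Z_U, G)` is a finite `A`-module and its `p^∞`-torsion is killed by
`p^c`; `G` is `p`-torsion-free (`Z` flat), and the Bockstein ladder gives: the reduction mod `p`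
of a frame of `G/p^{c+1} ≅ π^*E_c|_{U}` (free by Nakayama) lifts to `s : 𝒪^e_{Z_U} → G`, an
isomorphism on an open `Ω ⊇ V(p)`; `π` closed ⇒ `π_* G ≅ π_* 𝒪^e = 𝒪^e` near `V(p) ∩ U`; the
images of `(π_*G)/p` and of `E 0` in `π_{1*}π_1^*E 0` agree (comparison through the level-`c`
isomorphism, uniform `c` over a finite affine cover), whence a global `(π_*G)|X_1 ≅ E 0`; local
freeness on all of `𝒳` by GW II Lemma 24.96 (`𝒳 → Spec W` closed, `W` local).  Size L. -/
theorem stub_pushforwardDescent :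
    ∀ (p : ℕ) [Fact p.Prime] (k : Type) [Field k] [CharP k p] [PerfectRing k p]
      (𝒳 : SchemeOver (WittVector p k)), IsProper 𝒳.hom →
      ∀ (Z : SchemeOver (WittVector p k)) (π : Z ⟶ 𝒳),
        ChowLemmaRing.IsProjOver Z → Flat Z.hom →
        (∀ U : 𝒳.left.Opens, Function.Bijective (π.left.app U).hom) →
      ∀ (E : ∀ n : ℕ, (thickening 𝒳 (n + 1)).left.Modules), (∀ n, IsVectorBundle (E n)) →
        (∀ n, Nonempty ((Scheme.Modules.pullback
          (thickeningMap 𝒳 (Nat.le_succ (n + 1)))).obj (E (n + 1)) ≅ E n)) →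
      ∀ (G : Z.left.Modules), IsVectorBundle G →
        (∀ n, Nonempty ((Scheme.Modules.pullback (thickeningι Z (n + 1))).obj G ≅
          (Scheme.Modules.pullback
            ((baseChange (WittVector p k) (wittQuot p k (n + 1))).map π).left).obj (E n))) →
        IsVectorBundle ((Scheme.Modules.pushforward π.left).obj G) ∧
          Nonempty ((Scheme.Modules.pullback (thickeningι 𝒳 1)).obj
            ((Scheme.Modules.pushforward π.left).obj G) ≅ E 0) := by
  sorry

/-- **S3 (ENGINE, hardest) — UNIFORM TWIST PRESENTATION, ALGEBRAIZED IN `W[x₀,…,x_N]`.**  For a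
closed `W`-immersion `ι : Z ↪ P = ℙᴺ_W` with `Z` FLAT over `W`, every formal vector bundle `(F n)`
on `Z` (vector bundles on `Z_{n+1}`, `F (n+1)|Z_{n+1} ≅ F n`) is, level by level, the pull-back to
`Z` of the cokernel of ONE algebraic morphism `u : V' ⟶ V` of algebraic vector bundles ON THE
PROJECTIVE SPACE `P`: `(ι^* coker u)|Z_{n+1} ≅ F n` for every `n` (in the proof `V, V'` are sums of
twists `𝒪_P(-m)^r`, `𝒪_P(-m')^s` and `u` a matrix of forms of degree `m' - m` over `W`).
Paper (the idea card, steps S1–S6 there):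
`G_n := ι_{n*} F_{n-1}` is `W_n`-flat coherent on `P_n = ℙᴺ_{W_n}` with flat ladder
`0 → G₁ → G_{n+1} → G_n → 0`; Serre A+B on `ℙᴺ_k` for `G₁(m)` (and then for the first syzygy
`K₁(m')`, the kernels forming again a flat ladder since `Tor₁(G_{n+1}, W_n) = 0`) gives COMPATIBLE
presentations `𝒪_{P_n}(-m')^s —u_n→ 𝒪_{P_n}(-m)^r ↠ G_n`; `Hom = Mat_{r×s}(W_n[x]_{m'-m})` for every
`n`, so `u := lim u_n ∈ Mat(W[x]_{m'-m})` exists (`W = 𝕎 k` is `p`-adically complete, Mathlib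
`WittVector.isAdicCompleteIdealSpanP`); `V := 𝒪_P(-m)^r`, `V' := 𝒪_P(-m')^s` on `P`, and
`(ι^* coker u)|Z_{n+1} ≅ ι_{n+1}^* coker(u_n) ≅ ι_{n+1}^*ι_{n+1,*}F_n ≅ F_n` (right exactness of
pull-back; unit iso for closed immersions).  Why it might fail: only as COST — the dictionary
"coherent sheaf on `ℙᴺ_A` met here = (finite graded module)~, Čech = `LaurentCech` degreewise" is
the shared critical infrastructure (triage P2); the statement is EGA III₁ 5.1.4 on a projective
flat `Z` in presentation form.  Size XL. -/
theorem stub_twistPresentation :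
    ∀ (p : ℕ) [Fact p.Prime] (k : Type) [Field k] [CharP k p] [PerfectRing k p]
      (Z : SchemeOver (WittVector p k)) (N : ℕ) (ι : Z ⟶ ChowLemmaRing.projOver (WittVector p k) N),
      IsClosedImmersion ι.left → Flat Z.hom →
      ∀ (F : ∀ n : ℕ, (thickening Z (n + 1)).left.Modules), (∀ n, IsVectorBundle (F n)) →
        (∀ n, Nonempty ((Scheme.Modules.pullback
          (thickeningMap Z (Nat.le_succ (n + 1)))).obj (F (n + 1)) ≅ F n)) →
        ∃ (V V' : (ChowLemmaRing.projOver (WittVector p k) N).left.Modules) (u : V' ⟶ V),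
          IsVectorBundle V ∧ IsVectorBundle V' ∧
          ∀ n, Nonempty ((Scheme.Modules.pullback (thickeningι Z (n + 1))).obj
            ((Scheme.Modules.pullback ι.left).obj (cokernel u)) ≅ F n) := by
  sorry

/-- **S4 (engine finish) — A FORMALLY LOCALLY FREE COKERNEL IS LOCALLY FREE** (Görtz–Wedhorn II,
Prop 24.95 + Lemma 24.96, in the tree's vocabulary; the idea card's First lemma).  `Z` proper over
`W = W(k)`; `u : V' ⟶ V` a morphism of vector bundles on `Z`; if `(coker u)|Z_{n+1}` is a vector
bundle for every `n`, then `coker u` is a vector bundle.  Paper: at `x ∈ Z_k` the stalk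
`M = (coker u)_x` is finitely presented over the noetherian local `𝒪_{Z,x} ∋ p`, and
`M/pⁿM = ((coker u)|Z_n)_x` is free over `𝒪_{Z,x}/pⁿ` for all `n`, so `M` is flat by the local
criterion (Matsumura 22.3; tree `Literature/RingTheory/Flat/LocalCriterion`), hence free, hence
`coker u` is free near `x`; the free locus is an open `U ⊇ Z_k`, and `U = Z` because `Z → Spec W` is
a closed map to a local scheme (GW II Lemma 24.96).  Size M. -/
theorem stub_formallyFreeCokernel :
    ∀ (p : ℕ) [Fact p.Prime] (k : Type) [Field k] [CharP k p] [PerfectRing k p]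
      (Z : SchemeOver (WittVector p k)), IsProper Z.hom →
      ∀ (V V' : Z.left.Modules) (u : V' ⟶ V), IsVectorBundle V → IsVectorBundle V' →
        (∀ n : ℕ, IsVectorBundle ((Scheme.Modules.pullback (thickeningι Z (n + 1))).obj (cokernel u))) →
        IsVectorBundle (cokernel u) := by
  sorry

end Stubs

/-! ## 2. Named obligations (the four statements as `Prop`s, definitionally the stub types) -/

/-- Statement of S1. -/
def ChowFlatCover : Prop :=
  ∀ (p : ℕ) [Fact p.Prime] (k : Type) [Field k] [CharP k p] [PerfectRing k p] (d : ℕ)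
    (𝒳 : SchemeOver (WittVector p k)), IsSmoothProperModel d 𝒳 →
    ∃ (Z : SchemeOver (WittVector p k)) (π : Z ⟶ 𝒳),
      ChowLemmaRing.IsProjOver Z ∧ Flat Z.hom ∧
        ∀ U : 𝒳.left.Opens, Function.Bijective (π.left.app U).hom

/-- Statement of S2. -/
def PushforwardDescent : Prop :=
  ∀ (p : ℕ) [Fact p.Prime] (k : Type) [Field k] [CharP k p] [PerfectRing k p]
    (𝒳 : SchemeOver (WittVector p k)), IsProper 𝒳.hom →
    ∀ (Z : SchemeOver (WittVector p k)) (π : Z ⟶ 𝒳),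
      ChowLemmaRing.IsProjOver Z → Flat Z.hom →
      (∀ U : 𝒳.left.Opens, Function.Bijective (π.left.app U).hom) →
    ∀ (E : ∀ n : ℕ, (thickening 𝒳 (n + 1)).left.Modules), (∀ n, IsVectorBundle (E n)) →
      (∀ n, Nonempty ((Scheme.Modules.pullback
        (thickeningMap 𝒳 (Nat.le_succ (n + 1)))).obj (E (n + 1)) ≅ E n)) →
    ∀ (G : Z.left.Modules), IsVectorBundle G →
      (∀ n, Nonempty ((Scheme.Modules.pullback (thickeningι Z (n + 1))).obj G ≅
        (Scheme.Modules.pullback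
          ((baseChange (WittVector p k) (wittQuot p k (n + 1))).map π).left).obj (E n))) →
      IsVectorBundle ((Scheme.Modules.pushforward π.left).obj G) ∧
        Nonempty ((Scheme.Modules.pullback (thickeningι 𝒳 1)).obj
          ((Scheme.Modules.pushforward π.left).obj G) ≅ E 0)

/-- Statement of S3. -/
def TwistPresentation : Prop :=
  ∀ (p : ℕ) [Fact p.Prime] (k : Type) [Field k] [CharP k p] [PerfectRing k p]
    (Z : SchemeOver (WittVector p k)) (N : ℕ) (ι : Z ⟶ ChowLemmaRing.projOver (WittVector p k) N),
    IsClosedImmersion ι.left → Flat Z.hom →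
    ∀ (F : ∀ n : ℕ, (thickening Z (n + 1)).left.Modules), (∀ n, IsVectorBundle (F n)) →
      (∀ n, Nonempty ((Scheme.Modules.pullback
        (thickeningMap Z (Nat.le_succ (n + 1)))).obj (F (n + 1)) ≅ F n)) →
      ∃ (V V' : (ChowLemmaRing.projOver (WittVector p k) N).left.Modules) (u : V' ⟶ V),
        IsVectorBundle V ∧ IsVectorBundle V' ∧
        ∀ n, Nonempty ((Scheme.Modules.pullback (thickeningι Z (n + 1))).obj
          ((Scheme.Modules.pullback ι.left).obj (cokernel u)) ≅ F n)

/-- Statement of S4. -/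
def FormallyFreeCokernel : Prop :=
  ∀ (p : ℕ) [Fact p.Prime] (k : Type) [Field k] [CharP k p] [PerfectRing k p]
    (Z : SchemeOver (WittVector p k)), IsProper Z.hom →
    ∀ (V V' : Z.left.Modules) (u : V' ⟶ V), IsVectorBundle V → IsVectorBundle V' →
      (∀ n : ℕ, IsVectorBundle ((Scheme.Modules.pullback (thickeningι Z (n + 1))).obj (cokernel u))) →
      IsVectorBundle (cokernel u)

/-! ## 3. Vector bundles: the converse `IsVectorBundle → IsFiniteLocallyFree` (PROVED; credit
refuter-cdisprove-stmt-HodgeConjecture-13825, `Cruxes/FormalLiftingFromClassLifting/Disproof.lean`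
§12, copied verbatim so that nothing sorried is imported), pull-backs and isomorphic copies -/

universe u₄ v₄ u₄'

section RankFour

variable {C : Type u₄'} [Category.{v₄} C] {J : GrothendieckTopology C} {R : Sheaf J RingCat.{u₄}}
  [HasWeakSheafify J AddCommGrpCat.{u₄}] [J.WEqualsLocallyBijective AddCommGrpCat.{u₄}]

/-- Morphisms out of a free sheaf of modules are determined by their restrictions along the
tautological inclusions `ιFree i : 𝒪 ⟶ 𝒪^I`. -/
theorem free_hom_ext {I : Type u₄} {Z : SheafOfModules.{u₄} R} (f g : SheafOfModules.free I ⟶ Z)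
    (h : ∀ i, SheafOfModules.ιFree i ≫ f = SheafOfModules.ιFree i ≫ g) : f = g :=
  Cofan.IsColimit.hom_ext (SheafOfModules.isColimitFreeCofan I) _ _ fun i => h i

/-- An epimorphism `𝒪^K ↠ 𝒪^I` of free sheaves of modules with `K` finite forces `I` finite, on any
ringed site whose ring `End(𝒪)` is commutative with `𝟙 ≠ 0` (strong rank condition). -/
theorem finite_of_epi_free {I K : Type u₄} [Finite K]
    (hcomm : ∀ a b : End (SheafOfModules.unit R), a * b = b * a)
    (hnt : (𝟙 (SheafOfModules.unit R) : End (SheafOfModules.unit R)) ≠ 0)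
    (π : SheafOfModules.free (R := R) K ⟶ SheafOfModules.free (R := R) I) [Epi π] : Finite I := by
  classical
  letI : CommRing (End (SheafOfModules.unit R)) :=
    { (inferInstance : Ring (End (SheafOfModules.unit R))) with mul_comm := hcomm }
  haveI : Nontrivial (End (SheafOfModules.unit R)) := ⟨⟨_, _, hnt⟩⟩
  by_contra hI
  rw [not_finite_iff_infinite] at hI
  haveI := Fintype.ofFinite K
  let emb : Fin (Fintype.card K + 1) ↪ I := Fin.valEmbedding.trans (Infinite.natEmbedding I)
  let δ : (Fin (Fintype.card K + 1) → End (SheafOfModules.unit R)) →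
      I → End (SheafOfModules.unit R) :=
    fun c => Function.extend emb c (0 : I → End (SheafOfModules.unit R))
  have hδ_emb : ∀ c j, δ c (emb j) = c j := fun c j => emb.injective.extend_apply c 0 j
  have hδ_out : ∀ c i, (¬ ∃ j, emb j = i) → δ c i = 0 := fun c i hi =>
    Function.extend_apply' c (0 : I → End (SheafOfModules.unit R)) i hi
  have hδ_add : ∀ c c' i, δ (c + c') i = δ c i + δ c' i := by
    intro c c' i
    by_cases hi : ∃ j, emb j = i
    · obtain ⟨j, rfl⟩ := hi
      rw [hδ_emb, hδ_emb, hδ_emb, Pi.add_apply]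
    · rw [hδ_out c i hi, hδ_out c' i hi, hδ_out (c + c') i hi, add_zero]
  have hδ_smul : ∀ (b : End (SheafOfModules.unit R)) c i, δ (b • c) i = b * δ c i := by
    intro b c i
    by_cases hi : ∃ j, emb j = i
    · obtain ⟨j, rfl⟩ := hi
      rw [hδ_emb, hδ_emb, Pi.smul_apply, smul_eq_mul]
    · rw [hδ_out c i hi, hδ_out (b • c) i hi, mul_zero]
  let D : (Fin (Fintype.card K + 1) → End (SheafOfModules.unit R)) →
      (SheafOfModules.free (R := R) I ⟶ SheafOfModules.unit R) :=
    fun c => Cofan.IsColimit.desc (SheafOfModules.isColimitFreeCofan I)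
      (fun i => End.asHom (δ c i))
  have hD : ∀ c i, SheafOfModules.ιFree i ≫ D c = End.asHom (δ c i) :=
    fun c i => Cofan.IsColimit.fac (SheafOfModules.isColimitFreeCofan I) _ i
  have hD_add : ∀ c c', D (c + c') = D c + D c' := by
    intro c c'
    refine free_hom_ext _ _ fun i => ?_
    rw [Preadditive.comp_add, hD, hD, hD, hδ_add]
    rfl
  have hD_smul : ∀ (b : End (SheafOfModules.unit R)) c, D (b • c) = D c ≫ End.asHom b := by
    intro b c
    refine free_hom_ext _ _ fun i => ?_
    rw [hD, ← Category.assoc, hD, hδ_smul]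
    rfl
  let Φ : (Fin (Fintype.card K + 1) → End (SheafOfModules.unit R)) →ₗ[End (SheafOfModules.unit R)]
      (K → End (SheafOfModules.unit R)) :=
    { toFun := fun c k => End.of (SheafOfModules.ιFree k ≫ π ≫ D c)
      map_add' := fun c c' => by
        funext k
        change End.of (SheafOfModules.ιFree k ≫ π ≫ D (c + c')) =
          End.of (SheafOfModules.ιFree k ≫ π ≫ D c) + End.of (SheafOfModules.ιFree k ≫ π ≫ D c')
        rw [hD_add, Preadditive.comp_add, Preadditive.comp_add]
        rfl
      map_smul' := fun b c => by
        funext k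
        change End.of (SheafOfModules.ιFree k ≫ π ≫ D (b • c)) =
          b * End.of (SheafOfModules.ιFree k ≫ π ≫ D c)
        rw [hD_smul, End.mul_def]
        change SheafOfModules.ιFree k ≫ π ≫ D c ≫ End.asHom b =
          (SheafOfModules.ιFree k ≫ π ≫ D c) ≫ End.asHom b
        simp only [Category.assoc] }
  have hΦ : Function.Injective Φ := by
    intro c c' hcc'
    rw [← sub_eq_zero] at hcc' ⊢
    rw [← map_sub] at hcc'
    have h0 : ∀ k, SheafOfModules.ιFree k ≫ π ≫ D (c - c') = 0 := fun k => congrFun hcc' k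
    have h1 : π ≫ D (c - c') = 0 := by
      refine free_hom_ext _ _ fun k => ?_
      rw [comp_zero]
      exact h0 k
    have h2 : D (c - c') = 0 := by
      rw [← cancel_epi π, h1, comp_zero]
    funext j
    have h3 := hD (c - c') (emb j)
    rw [h2, comp_zero, hδ_emb] at h3
    exact h3.symm
  have hcard := card_le_of_injective (End (SheafOfModules.unit R)) Φ hΦ
  simp only [Fintype.card_fin] at hcard
  omega

end RankFour

section EndUnitFour

open Opposite

variable {X : Scheme.{u₄}} (W : X.Opens)

/-- `End(𝒪)` is commutative on the site of opens over `W` (open by open an endomorphism of the unit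
module is multiplication by its value on `1`; sections of `𝒪_X` commute). -/
theorem end_unit_mul_comm (a b : End (SheafOfModules.unit (X.ringCatSheaf.over W))) :
    a * b = b * a := by
  change b ≫ a = a ≫ b
  refine SheafOfModules.hom_ext (PresheafOfModules.hom_ext fun Y => ModuleCat.hom_ext
    (LinearMap.ext fun y => ?_))
  let f : (X.ringCatSheaf.over W).obj.obj Y →ₗ[(X.ringCatSheaf.over W).obj.obj Y]
      (X.ringCatSheaf.over W).obj.obj Y := (a.val.app Y).hom
  let g : (X.ringCatSheaf.over W).obj.obj Y →ₗ[(X.ringCatSheaf.over W).obj.obj Y]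
      (X.ringCatSheaf.over W).obj.obj Y := (b.val.app Y).hom
  obtain ⟨z, rfl⟩ : ∃ z : (X.ringCatSheaf.over W).obj.obj Y, z = y := ⟨y, rfl⟩
  change f (g z) = g (f z)
  have hf : ∀ t, f t = t * f 1 := fun t => by
    have h := f.map_smul t 1
    rwa [smul_eq_mul, mul_one, smul_eq_mul] at h
  have hg : ∀ t, g t = t * g 1 := fun t => by
    have h := g.map_smul t 1
    rwa [smul_eq_mul, mul_one, smul_eq_mul] at h
  rw [hg z, hf (z * _), hf z, hg (z * _)]
  have key : ∀ r s t : Γ(X, Y.unop.left), r * s * t = r * t * s := fun r s t => mul_right_comm r s t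
  exact key _ _ _

/-- `𝟙 ≠ 0` in `End(𝒪)` over a non-empty open `W` of a scheme. -/
theorem end_unit_id_ne_zero [Nonempty W] :
    (𝟙 (SheafOfModules.unit (X.ringCatSheaf.over W)) :
      End (SheafOfModules.unit (X.ringCatSheaf.over W))) ≠ 0 := by
  intro h0
  have key := congrArg (fun u : SheafOfModules.unit (X.ringCatSheaf.over W) ⟶
      SheafOfModules.unit (X.ringCatSheaf.over W) =>
        ((u.val.app (op (Over.mk (𝟙 W)))).hom
          (1 : (X.ringCatSheaf.over W).obj.obj (op (Over.mk (𝟙 W)))) :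
          (X.ringCatSheaf.over W).obj.obj (op (Over.mk (𝟙 W))))) h0
  change (1 : Γ(X, W)) = 0 at key
  exact one_ne_zero key

/-- **A vector bundle on a scheme is finite locally free** (Stacks 01C6; the converse of the tree's
`IsFiniteLocallyFree.isVectorBundle`): at `x`, a trivialisation `E|_U ≅ 𝒪^I` and finitely many
generators of `E|_V` restrict to `W = U ∩ V ∋ x`, giving `𝒪^K ↠ 𝒪^I` over `W ≠ ∅`, whence `I` is
finite (`finite_of_epi_free`). -/
theorem isFiniteLocallyFree_of_isVectorBundle {E : X.Modules} (h : IsVectorBundle E) :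
    IsFiniteLocallyFree E := by
  classical
  obtain ⟨q, hq⟩ := h.1.exists_isLocallyFreeData
  haveI := h.2
  obtain ⟨q', hq'⟩ := SheafOfModules.IsFiniteType.exists_localGeneratorsData E
  intro x
  obtain ⟨a, ha⟩ := ((Opens.coversTop_iff _ q.X).mp q.coversTop).exists_mem x
  obtain ⟨b, hb⟩ := ((Opens.coversTop_iff _ q'.X).mp q'.coversTop).exists_mem x
  refine ⟨q.X a, ha, (q.generators a).I, ?_, ⟨asIso (q.generators a).π⟩⟩
  let W : X.Opens := q.X a ⊓ q'.X b
  haveI : Nonempty W := ⟨⟨x, ⟨ha, hb⟩⟩⟩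
  haveI : (q'.generators b).IsFiniteType := hq'.isFiniteType b
  let eW : SheafOfModules.free (q.generators a).I ≅ E.over W :=
    SheafOfModules.restrictTrivialisation (R := X.ringCatSheaf) (homOfLE inf_le_left)
      (asIso (q.generators a).π)
  let g : W ⟶ q'.X b := homOfLE inf_le_right
  let πW : SheafOfModules.free (q'.generators b).I ⟶ E.over W :=
    (SheafOfModules.mapFreeIso (SheafOfModules.overMap X.ringCatSheaf g) _
        (SheafOfModules.overMapUnitIso g).symm).hom ≫
      (SheafOfModules.overMap X.ringCatSheaf g).map (q'.generators b).π ≫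
        ((SheafOfModules.overFunctorMap X.ringCatSheaf g).app E).hom
  haveI : Epi πW := by
    dsimp only [πW]
    infer_instance
  exact finite_of_epi_free (end_unit_mul_comm W) (end_unit_id_ne_zero W) (πW ≫ eW.inv)

end EndUnitFour

section VectorBundles

variable {X Y : Scheme.{u₄}}

/-- Finite local freeness is invariant under isomorphism. -/
theorem isFiniteLocallyFree_congr {E E' : X.Modules} (e : E ≅ E') (h : IsFiniteLocallyFree E) :
    IsFiniteLocallyFree E' := fun x => by
  obtain ⟨U, hx, I, hI, ⟨i⟩⟩ := h x
  exact ⟨U, hx, I, hI, ⟨i ≪≫ (Scheme.Modules.overFunctor U).mapIso e⟩⟩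

/-- Being a vector bundle is invariant under isomorphism. -/
theorem isVectorBundle_congr {E E' : X.Modules} (e : E ≅ E') (h : IsVectorBundle E) :
    IsVectorBundle E' :=
  (isFiniteLocallyFree_congr e (isFiniteLocallyFree_of_isVectorBundle h)).isVectorBundle

/-- **Pull-backs of vector bundles are vector bundles** (Stacks 01C8, via the converse above and
the tree's `IsFiniteLocallyFree.pullback`). -/
theorem isVectorBundle_pullback {E : Y.Modules} (h : IsVectorBundle E) (f : X ⟶ Y) :
    IsVectorBundle ((Scheme.Modules.pullback f).obj E) :=
  ((isFiniteLocallyFree_of_isVectorBundle h).pullback f).isVectorBundle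

end VectorBundles

/-! ## 4. Thickenings of a `W`-morphism: the base-change square and the pulled-back tower (PROVED) -/

section Thickenings

variable {p : ℕ} [Fact p.Prime] {k : Type} [CommRing k] {Z 𝒳 : SchemeOver (WittVector p k)}

/-- The map of `m`-th thickenings `Z_m ⟶ X_m` induced by a `W`-morphism `π : Z ⟶ 𝒳` (base change
of `π` along `W → W/pᵐ`). An `abbrev`: the stubs spell it out. -/
abbrev thickeningMapOver (π : Z ⟶ 𝒳) (m : ℕ) : (thickening Z m).left ⟶ (thickening 𝒳 m).left :=
  ((baseChange (WittVector p k) (wittQuot p k m)).map π).left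

/-- `Z_m ⟶ X_m ⟶ 𝒳 = Z_m ⟶ Z ⟶ 𝒳`. -/
theorem thickeningMapOver_ι (π : Z ⟶ 𝒳) (m : ℕ) :
    thickeningMapOver π m ≫ thickeningι 𝒳 m = thickeningι Z m ≫ π.left :=
  pullback.lift_fst _ _ _

/-- `Z_m ⟶ X_m ⟶ Spec W_m = Z_m ⟶ Spec W_m`. -/
theorem thickeningMapOver_snd (π : Z ⟶ 𝒳) (m : ℕ) :
    thickeningMapOver π m ≫ pullback.snd 𝒳.hom
        (Spec.map (CommRingCat.ofHom (algebraMap (WittVector p k) (wittQuot p k m)))) =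
      pullback.snd Z.hom
        (Spec.map (CommRingCat.ofHom (algebraMap (WittVector p k) (wittQuot p k m)))) :=
  pullback.lift_snd _ _ _

/-- **The base-change square of the towers**: `Z_m ⟶ Z_n ⟶ X_n = Z_m ⟶ X_m ⟶ X_n` for `m ≤ n`. -/
theorem thickeningMap_comp_thickeningMapOver (π : Z ⟶ 𝒳) {m n : ℕ} (h : m ≤ n) :
    thickeningMap Z h ≫ thickeningMapOver π n = thickeningMapOver π m ≫ thickeningMap 𝒳 h := by
  apply pullback.hom_ext
  · exact ((Category.assoc _ _ _).trans <|
      (congrArg (thickeningMap Z h ≫ ·) (thickeningMapOver_ι π n)).trans <|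
        (Category.assoc _ _ _).symm.trans <|
          congrArg (· ≫ π.left) (thickeningMap_ι Z h)).trans <|
      ((Category.assoc _ _ _).trans <|
        (congrArg (thickeningMapOver π m ≫ ·) (thickeningMap_ι 𝒳 h)).trans <|
          thickeningMapOver_ι π m).symm
  · exact ((Category.assoc _ _ _).trans <|
      (congrArg (thickeningMap Z h ≫ ·) (thickeningMapOver_snd π n)).trans <|
        thickeningMap_snd Z h).trans <|
      ((Category.assoc _ _ _).trans <|
        (congrArg (thickeningMapOver π m ≫ ·) (thickeningMap_snd 𝒳 h)).trans <|
          (Category.assoc _ _ _).symm.trans <|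
            congrArg (· ≫ Spec.map (CommRingCat.ofHom (Ideal.Quotient.factor
              (Ideal.pow_le_pow_right (I := Ideal.span {(p : WittVector p k)}) h))))
              (thickeningMapOver_snd π m)).symm

/-- Pulling back along the tower maps commutes with pulling back along `π`:
`(π_n^* M)|Z_m ≅ π_m^* (M|X_m)`. -/
def pullbackTowerIso (π : Z ⟶ 𝒳) {m n : ℕ} (h : m ≤ n) (M : (thickening 𝒳 n).left.Modules) :
    (Scheme.Modules.pullback (thickeningMap Z h)).obj
        ((Scheme.Modules.pullback (thickeningMapOver π n)).obj M) ≅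
      (Scheme.Modules.pullback (thickeningMapOver π m)).obj
        ((Scheme.Modules.pullback (thickeningMap 𝒳 h)).obj M) :=
  (Scheme.Modules.pullbackComp (thickeningMap Z h) (thickeningMapOver π n)).app M ≪≫
    (Scheme.Modules.pullbackCongr (thickeningMap_comp_thickeningMapOver π h)).app M ≪≫
      ((Scheme.Modules.pullbackComp (thickeningMapOver π m) (thickeningMap 𝒳 h)).app M).symm

end Thickenings

/-! ## 5. Glue: last step and the composition (PROVED) -/

section Glue

variable {p : ℕ} [Fact p.Prime] {k : Type} [Field k] [CharP k p]

/-- **Last glue step** (as in `IdeatorTwoSketch.liftsTo_of_levelOne`): a vector bundle `G` on `𝒳`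
with `G|X_1 ≅ E 0` and `E 0|X_k ≅ E₁` witnesses `LiftsTo 𝒳 E₁` (`X_k ⟶ X_1 ⟶ 𝒳 = X_k ⟶ 𝒳`). -/
theorem liftsTo_of_levelOne (𝒳 : SchemeOver (WittVector p k)) (G : 𝒳.left.Modules)
    (hG : IsVectorBundle G) (E₁ : (specialFibre 𝒳).left.Modules)
    (E0 : (thickening 𝒳 1).left.Modules)
    (e : (Scheme.Modules.pullback (thickeningι 𝒳 1)).obj G ≅ E0)
    (e₀ : (Scheme.Modules.pullback (specialFibreToThickening 𝒳 0)).obj E0 ≅ E₁) :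
    LiftsTo 𝒳 E₁ :=
  ⟨G, hG, ⟨(Scheme.Modules.pullbackCongr (specialFibreToThickening_ι 𝒳 0).symm).app G ≪≫
      ((Scheme.Modules.pullbackComp (specialFibreToThickening 𝒳 0) (thickeningι 𝒳 1)).app G).symm ≪≫
      (Scheme.Modules.pullback (specialFibreToThickening 𝒳 0)).mapIso e ≪≫ e₀⟩⟩

/-- **The composition, implication form** (kernel-checked, no `sorry`): the four obligations imply
the crux statement.  FRAME: Chow–Stein cover `π : Z ⟶ 𝒳` (S1); pull the tower back to `Z`;
ENGINE: present it (S3) and conclude local freeness of the cokernel `G` (S4); FRAME: descend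
`π_* G` (S2); finish with `liftsTo_of_levelOne`. -/
theorem liftsTo_of_obligations (h₁ : ChowFlatCover) (h₂ : PushforwardDescent)
    (h₃ : TwistPresentation) (h₄ : FormallyFreeCokernel) :
    ∀ (p : ℕ) [Fact p.Prime] (k : Type) [Field k] [CharP k p] [PerfectRing k p] (d : ℕ)
      (𝒳 : SchemeOver (WittVector p k)), IsSmoothProperModel d 𝒳 →
      ∀ (E₁ : (specialFibre 𝒳).left.Modules), LiftsFormally 𝒳 E₁ → LiftsTo 𝒳 E₁ := by
  intro p _ k _ _ _ d 𝒳 h𝒳 E₁ hE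
  obtain ⟨E, hEvb, hstep, ⟨e0⟩⟩ := hE
  obtain ⟨Z, π, hZproj, hZflat, hN⟩ := h₁ p k d 𝒳 h𝒳
  -- the pulled-back tower on `Z`
  let F : ∀ n : ℕ, (thickening Z (n + 1)).left.Modules := fun n =>
    (Scheme.Modules.pullback (thickeningMapOver π (n + 1))).obj (E n)
  have hFvb : ∀ n, IsVectorBundle (F n) := fun n => isVectorBundle_pullback (hEvb n) _
  have hFstep : ∀ n, Nonempty ((Scheme.Modules.pullback
      (thickeningMap Z (Nat.le_succ (n + 1)))).obj (F (n + 1)) ≅ F n) := fun n => by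
    obtain ⟨s⟩ := hstep n
    exact ⟨pullbackTowerIso π (Nat.le_succ (n + 1)) (E (n + 1)) ≪≫
      (Scheme.Modules.pullback (thickeningMapOver π (n + 1))).mapIso s⟩
  -- ENGINE: present the pulled-back tower from `ℙᴺ_W` (S3) …
  obtain ⟨N, ι, hι⟩ := hZproj
  obtain ⟨V, V', u, hV, hV', hcoker⟩ := h₃ p k Z N ι hι hZflat F hFvb hFstep
  -- … `G := coker (ι^* u) ≅ ι^* coker u` (pull-back is a left adjoint, hence right exact) …
  let G : Z.left.Modules := cokernel ((Scheme.Modules.pullback ι.left).map u)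
  let eG : (Scheme.Modules.pullback ι.left).obj (cokernel u) ≅ G :=
    PreservesCokernel.iso (Scheme.Modules.pullback ι.left) u
  have hGF : ∀ n, Nonempty ((Scheme.Modules.pullback (thickeningι Z (n + 1))).obj G ≅ F n) :=
    fun n => (hcoker n).map fun e =>
      (Scheme.Modules.pullback (thickeningι Z (n + 1))).mapIso eG.symm ≪≫ e
  have hGn : ∀ n, IsVectorBundle
      ((Scheme.Modules.pullback (thickeningι Z (n + 1))).obj G) := fun n => by
    obtain ⟨e⟩ := hGF n
    exact isVectorBundle_congr e.symm (hFvb n)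
  -- … and conclude local freeness of `G` (S4)
  have hG : IsVectorBundle G :=
    h₄ p k Z (ChowLemmaRing.IsProjOver.isProper ⟨N, ι, hι⟩) _ _ _ (isVectorBundle_pullback hV ι.left)
      (isVectorBundle_pullback hV' ι.left) hGn
  -- FRAME: descend along `π` (S2)
  obtain ⟨hπG, ⟨e1⟩⟩ :=
    h₂ p k 𝒳 h𝒳.isProper Z π ⟨N, ι, hι⟩ hZflat hN E hEvb hstep G hG hGF
  exact liftsTo_of_levelOne 𝒳 _ hπG E₁ (E 0) e1 e0

/-- **The crux BY NAME from the four registered stubs** (`sorryAx` enters only through them). -/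
theorem FormalVectorBundlesAlgebraize_of : FormalVectorBundlesAlgebraize :=
  liftsTo_of_obligations stub_chowFlatCover stub_pushforwardDescent stub_twistPresentation
    stub_formallyFreeCokernel

end Glue

/-! ## 6. The projective case from the ENGINE alone (PROVED modulo S3, S4)

Every consumer of the crux in the route (`FormalLiftingFromClassLifting`, the anchors) carries
`Crystalline.IsProjectiveOverRing 𝒳`; for such `𝒳` the frame stubs S1/S2 are not needed
(triage panel note P1(b)).  `Crystalline.projectiveSpaceOver n W` and `ChowLemmaRing.projOver W n`
are the same `W`-scheme, definitionally. -/

section Projective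

/-- The two models of `ℙⁿ` over a ring in the tree agree on the nose:
`ChowLemmaRing.projOver R n` (Chow's lemma, `IsProjOver`) is `Crystalline.projectiveSpaceOver n R`
(the route's `IsProjectiveOverRing`). -/
theorem projOver_eq (R : Type) [CommRing R] (n : ℕ) :
    ChowLemmaRing.projOver R n = Crystalline.projectiveSpaceOver n R := rfl

/-- Hence the route's projectivity predicate IS the one produced by Chow's lemma. -/
theorem isProjOver_iff_isProjectiveOverRing {R : Type} [CommRing R] (X : SchemeOver R) :
    ChowLemmaRing.IsProjOver X ↔ Crystalline.IsProjectiveOverRing X := Iff.rfl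

variable {p : ℕ} [Fact p.Prime] {k : Type} [Field k] [CharP k p]

/-- **Projective case of the crux from the two ENGINE stubs.** -/
theorem projectiveCase_of_engine (h₃ : TwistPresentation) (h₄ : FormallyFreeCokernel) :
    ∀ (p : ℕ) [Fact p.Prime] (k : Type) [Field k] [CharP k p] [PerfectRing k p] (d : ℕ)
      (𝒳 : SchemeOver (WittVector p k)), IsSmoothProperModel d 𝒳 →
      Crystalline.IsProjectiveOverRing 𝒳 →
      ∀ (E₁ : (specialFibre 𝒳).left.Modules), LiftsFormally 𝒳 E₁ → LiftsTo 𝒳 E₁ := by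
  intro p _ k _ _ _ d 𝒳 h𝒳 hproj E₁ hE
  obtain ⟨E, hEvb, hstep, ⟨e0⟩⟩ := hE
  haveI := h𝒳.smoothOfRelativeDimension
  haveI : Smooth 𝒳.hom := SmoothOfRelativeDimension.smooth d 𝒳.hom
  have hflat : Flat 𝒳.hom := inferInstance
  obtain ⟨N, ι, hι⟩ := (isProjOver_iff_isProjectiveOverRing 𝒳).mpr hproj
  obtain ⟨V, V', u, hV, hV', hcoker⟩ := h₃ p k 𝒳 N ι hι hflat E hEvb hstep
  let G : 𝒳.left.Modules := cokernel ((Scheme.Modules.pullback ι.left).map u)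
  let eG : (Scheme.Modules.pullback ι.left).obj (cokernel u) ≅ G :=
    PreservesCokernel.iso (Scheme.Modules.pullback ι.left) u
  have hGE : ∀ n, Nonempty ((Scheme.Modules.pullback (thickeningι 𝒳 (n + 1))).obj G ≅ E n) :=
    fun n => (hcoker n).map fun e =>
      (Scheme.Modules.pullback (thickeningι 𝒳 (n + 1))).mapIso eG.symm ≪≫ e
  have hGn : ∀ n, IsVectorBundle
      ((Scheme.Modules.pullback (thickeningι 𝒳 (n + 1))).obj G) := fun n => by
    obtain ⟨e⟩ := hGE n
    exact isVectorBundle_congr e.symm (hEvb n)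
  have hG : IsVectorBundle G :=
    h₄ p k 𝒳 h𝒳.isProper _ _ _ (isVectorBundle_pullback hV ι.left)
      (isVectorBundle_pullback hV' ι.left) hGn
  obtain ⟨e1⟩ := hGE 0
  exact liftsTo_of_levelOne 𝒳 _ hG E₁ (E 0) e1 e0

end Projective

end

end Summit.HodgeConjecture.HodgeConjecture.Cruxes.FormalVectorBundlesAlgebraize.TwistPresentationCompleteness
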